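import Literature.NumberTheory.LFunctions.ZeroDensityNearOneDetection
import Literature.NumberTheory.LFunctions.GuthMaynardZeroSumDecay
import Literature.NumberTheory.LFunctions.ZetaFirstZeroCertificate
import HarnessLib

/-!
# Ivić 1985, Theorem 11.3 — node D of the discharge: the three reductions of the detection step

LABEL (line 1): **NOT RH-BEARING** (D-0040; bears_on LADDER-RH §4 HELD row `DensityLadder`,
stmt-19600): a zero-density theorem COUNTS zeros of `ζ` off the critical line, it never empties
the strip (`Literature.Barriers.RiemannHypothesis.LindelofBacklund`); RH-FREE literature; nothing
in this file is worded as progress toward RH and nothing here bears on the truth of RH.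

Topic `NumberTheory/LFunctions`, family RH, statement **rh.S12**; corpus C4 (rh-crit/gm), unit
I3 = the discharge of the named fact `Literature.NumberTheory.LFunctions.Ivic1985_theorem11_3`
(Ivić, *The Riemann Zeta-Function* (1985), Theorem 11.3, (11.32):
`N(σ, T) ≪ M(5σ − 4, 3T)^{7/6} log^{169/12} T` for `9/10 ≤ σ ≤ 1`, `M(α, T) = max_{1≤t≤T}|ζ(α+it)|`,
typed in `ZeroDensityNearOne.lean` with "every `M ≥ sup_{1 ≤ t ≤ 3T} |ζ(5σ − 4 + it)|`").

The detection step itself (Ivić §11.2 (11.9)–(11.10) with the line of (11.45), the Class I /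
Class II dichotomy at level `α = 5σ − 4`) is the tree theorem
`Literature.NumberTheory.LFunctions.NearOneDetect.perZero_dichotomy_line`
(`ZeroDensityNearOneDetection.lean`), which the apex of the unit consumes VERBATIM; this file adds
only the three bookkeeping REDUCTIONS the apex needs around it (gm/I3-CENSUS.md §N row D, §R;
shapes agreed with the apex seat on gm/STATUS.md 2026-08-26T08:32Z):

* (R1) `exists_pos_le_of_majorant` — an ABSOLUTE `c₀ > 0` with `c₀ ≤ M` for every admissible
  majorant `M ≥ sup_{1 ≤ t ≤ 3T}|ζ(α + it)|`, `1/2 ≤ α ≤ 1`, `T ≥ 1` (from `|ζ(α + i)| ≥ c₀`: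
  no zero of `ζ` has `0 < Im ≤ 14`, continuity, compactness of `[1/2, 1]`), with
  `exists_pos_le_norm_riemannZeta_add_I` and `exists_pos_le_of_zeta_line_bound` (the shape of the
  typed fact's hypothesis). It lets the terms of Ivić's proof that carry no power of `M` (bounded
  heights, the near-`σ = 1` regime) be absorbed into `C · M^{7/6} (log T)^{169/12}`. This block is
  the scratch file `gm/scratch-t1/ZetaHeightOneLowerBound.lean` (v2, sha16 `344f2a28343debe1`) of
  seat rh-crit-gm-t1, pasted byte-identically (credit: rh-crit-gm-t1 g3).
* (R2) `IvicNearOneDetect.zetaZeroCountRe_eq_zero_of_clamp` — the Vinogradov–Korobov clamp: for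
  `T ≥ T₁` and `σ > 1 − c (log T)^{−5/7}` the counting box is EMPTY, `N(σ, T) = 0` (one step from
  `GuthMaynard2026.exists_zeroFree_upTo`). In Ivić's proof this is the remark that for `1 − σ`
  below the zero-free region there is nothing to count; in the unit it bounds `log(1/(1 − σ))`,
  `log X`, `log Y` by `O(log T)` (census §R).
* (R3) `IvicNearOneDetect.norm_zeta_line_le_of_majorant` — the pole window (census F-E): from the
  typed majorant on `1 ≤ t ≤ 3T` and the crude bound `|ζ(α' + it)| ≤ 1/(1 − α') + K(1 + |t|)`
  (`NearOneDetect.exists_norm_zeta_line_le`) to `|ζ(5σ − 4 + it)| ≤ M + 1/(5(1 − σ)) + 2K` for ALL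
  `|t| ≤ 3T` (conjugation `ζ(s̄) = conj ζ(s)` for `t < 0`, the crude bound on `|t| < 1`), together
  with the `|t|`-symmetric twin `norm_zeta_line_le_of_majorant_abs` (the `hM` shape of the class-I
  count `IvicClassOne.count`) and the height-`U` form `norm_zeta_line_le_of_majorant_height`
  (the `hS` shape of `NearOneDetect.classTwo_integral_le_line` / `norm_smoothedKernel_le_line`).

Everything is PROVED; no definition, no named fact (D-0026).

## References

* A. Ivić, *The Riemann Zeta-Function* (Wiley, 1985), §11.4, Theorem 11.3 and its proof,
  (11.44)–(11.52), pp. 277–281 (held chunks p0214–p0216); §11.2 (11.9)–(11.12). [`Ivic1985`]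
* L. Guth, J. Maynard, *New large value estimates for Dirichlet polynomials*, Ann. of Math. (2)
  203 (2026), §13.2 (the Vinogradov–Korobov input "`N(σ,T) = 0` for
  `σ ≥ 1 − c(log T)^{−2/3}(log log T)^{−1/3}`"). [`GuthMaynard2026`]
* E. C. Titchmarsh, *The Theory of the Riemann Zeta-Function*, 2nd ed. (1986), §2.12 (the crude
  bound), §9.1. [`Titchmarsh1986`]
-/

noncomputable section

open Complex Set

namespace Literature.NumberTheory.LFunctions

/-! ## (R1) A positive lower bound for every admissible majorant
(block of seat rh-crit-gm-t1 g3, `gm/scratch-t1/ZetaHeightOneLowerBound.lean` v2,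
sha16 `344f2a28343debe1`, pasted byte-identically) -/

/-- **`|ζ(α + i)| ≥ c₀ > 0` uniformly for `1/2 ≤ α ≤ 1`** (indeed for `0 ≤ α ≤ 2`): `ζ` has no zero
at height `1` (`N(14) = 0`), `α ↦ |ζ(α + i)|` is continuous on the compact interval, hence bounded
below by a positive constant. [cite: Ivic1985, §11.4, Theorem 11.3 (the majorant `M(α,T) = max_{1≤t≤T}|ζ(α+it)|`), p. 277; Edwards1974, §6.6 (no zeros with `0 < Im s ≤ 14`)] -/
theorem exists_pos_le_norm_riemannZeta_add_I :
    ∃ c : ℝ, 0 < c ∧ ∀ α : ℝ, 1 / 2 ≤ α → α ≤ 1 →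
      c ≤ ‖riemannZeta ((α : ℂ) + (1 : ℝ) * I)‖ := by
  set f : ℝ → ℝ := fun α ↦ ‖riemannZeta ((α : ℂ) + (1 : ℝ) * I)‖ with hf
  have hne1 : ∀ α : ℝ, (α : ℂ) + (1 : ℝ) * I ≠ 1 := by
    intro α h
    have := congrArg Complex.im h
    simp at this
  have hcont : ContinuousOn f (Icc (1 / 2 : ℝ) 1) := by
    refine Continuous.continuousOn ?_
    refine Continuous.norm ?_
    have hg : Continuous fun α : ℝ ↦ (α : ℂ) + (1 : ℝ) * I := by fun_prop
    refine continuous_iff_continuousAt.2 fun α ↦ ?_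
    have hζ : ContinuousAt riemannZeta ((fun α : ℝ ↦ (α : ℂ) + (1 : ℝ) * I) α) :=
      (differentiableAt_riemannZeta (hne1 α)).continuousAt
    exact ContinuousAt.comp (f := fun α : ℝ ↦ (α : ℂ) + (1 : ℝ) * I) hζ hg.continuousAt
  have hpos : ∀ α ∈ Icc (1 / 2 : ℝ) 1, 0 < f α := by
    intro α _
    refine norm_pos_iff.mpr (riemannZeta_ne_zero_of_im_pos_of_im_le_fourteen ?_ ?_)
    · simp
    · norm_num
  obtain ⟨α₀, hα₀, hmin⟩ :=
    (isCompact_Icc : IsCompact (Icc (1 / 2 : ℝ) 1)).exists_isMinOn ⟨1, by norm_num⟩ hcont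
  refine ⟨f α₀, hpos α₀ hα₀, fun α h1 h2 ↦ ?_⟩
  exact hmin (show α ∈ Icc (1 / 2 : ℝ) 1 from ⟨h1, h2⟩)

/-- Corollary in the shape of `Ivic1985_theorem11_3`'s hypothesis: if `|ζ((5σ−4) + it)| ≤ M` for
`1 ≤ t ≤ 3T` (`T ≥ 1/3`, `9/10 ≤ σ ≤ 1`), then `M ≥ c₀`. [cite: Ivic1985, §11.4, Theorem 11.3 (the majorant `M(α,T) = max_{1≤t≤T}|ζ(α+it)|`), p. 277; Edwards1974, §6.6 (no zeros with `0 < Im s ≤ 14`)] -/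
theorem exists_pos_le_of_zeta_line_bound :
    ∃ c : ℝ, 0 < c ∧ ∀ T : ℝ, 1 / 3 ≤ T → ∀ σ : ℝ, 9 / 10 ≤ σ → σ ≤ 1 → ∀ M : ℝ,
      (∀ t : ℝ, 1 ≤ t → t ≤ 3 * T → ‖riemannZeta ((5 * σ - 4 : ℝ) + t * I)‖ ≤ M) → c ≤ M := by
  obtain ⟨c, hc, h⟩ := exists_pos_le_norm_riemannZeta_add_I
  refine ⟨c, hc, fun T hT σ h1 h2 M hM ↦ ?_⟩
  have h1' : (1 : ℝ) / 2 ≤ 5 * σ - 4 := by linarith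
  have h2' : 5 * σ - 4 ≤ (1 : ℝ) := by linarith
  have hb := hM 1 le_rfl (by linarith)
  have hlow := h (5 * σ - 4) h1' h2'
  push_cast at hb hlow ⊢
  exact hlow.trans hb

/-- The same in the node-A consumer's shape (gm/STATUS rh-crit-gm-t8 08:32:24Z, (R1)): an absolute
`c₀ > 0` with `c₀ ≤ M` whenever `|ζ(α + it)| ≤ M` on `1 ≤ t ≤ 3T`, `1/2 ≤ α ≤ 1`, `T ≥ 1`.
[cite: Ivic1985, §11.4, Theorem 11.3 (the majorant `M(α,T) = max_{1≤t≤T}|ζ(α+it)|`), p. 277; Edwards1974, §6.6 (no zeros with `0 < Im s ≤ 14`)] -/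
theorem exists_pos_le_of_majorant :
    ∃ c₀ : ℝ, 0 < c₀ ∧ ∀ α T M : ℝ, 1 / 2 ≤ α → α ≤ 1 → 1 ≤ T →
      (∀ t : ℝ, 1 ≤ t → t ≤ 3 * T → ‖riemannZeta ((α : ℂ) + t * I)‖ ≤ M) → c₀ ≤ M := by
  obtain ⟨c, hc, h⟩ := exists_pos_le_norm_riemannZeta_add_I
  refine ⟨c, hc, fun α T M h1 h2 hT hM ↦ ?_⟩
  have hb := hM 1 le_rfl (by linarith)
  have hlow := h α h1 h2
  push_cast at hb hlow ⊢
  exact hlow.trans hb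

namespace IvicNearOneDetect

/-! ## (R2) The Vinogradov–Korobov clamp: the counting box is empty above `1 − c (log T)^{−5/7}` -/

/-- **`N(σ, T) = 0` for `σ > 1 − c (log T)^{−5/7}`, `T ≥ T₁`** (with `c (log T)^{−5/7} ≤ 1/2`
there): every zero `ρ` of `ζ` with `|Im ρ| ≤ T` has `Re ρ ≤ 1 − c (log T)^{−5/7}`
(`GuthMaynard2026.exists_zeroFree_upTo`: the tree's Vinogradov–Korobov region from its Richert-type
bound, weakened to the exponent `5/7`, plus the de la Vallée-Poussin region at bounded height), so
the box `{ζ ρ = 0, σ ≤ Re ρ ≤ 1, 0 < Im ρ ≤ T}` defining `zetaZeroCountRe σ T` is empty. In Ivić's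
proof of Theorem 11.3 this disposes of `1 − σ` inside the zero-free region, so that `1/(1 − σ)`,
`log X` and `log Y` are `O(log T)`-powers in the remaining range.
[cite: Ivic1985, §11.4, proof of Theorem 11.3, p. 281 ("if `σ` is sufficiently close to unity")]
[cite: GuthMaynard2026, §13.2] -/
theorem zetaZeroCountRe_eq_zero_of_clamp :
    ∃ c : ℝ, 0 < c ∧ ∃ T₁ : ℝ, 3 ≤ T₁ ∧ ∀ T : ℝ, T₁ ≤ T →
      c / Real.log T ^ (5 / 7 : ℝ) ≤ 1 / 2 ∧
      ∀ σ : ℝ, 1 - c / Real.log T ^ (5 / 7 : ℝ) < σ → zetaZeroCountRe σ T = 0 := by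
  obtain ⟨c, hc, T₁, hT₁, h⟩ := GuthMaynard2026.exists_zeroFree_upTo
  refine ⟨c, hc, T₁, hT₁, fun T hT ↦ ⟨(h T hT).1, fun σ hσ ↦ ?_⟩⟩
  have hbox : zetaZeroBox σ T = ∅ := by
    ext ρ
    simp only [zetaZeroBox, Set.mem_setOf_eq, Set.mem_empty_iff_false, iff_false]
    rintro ⟨h0, h1, -, h3, h4⟩
    have him : |ρ.im| ≤ T := by rw [abs_of_pos h3]; exact h4
    have hre := (h T hT).2 ρ h0 him
    linarith
  simp [zetaZeroCountRe, hbox]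

/-- Corollary in the consumer's `η = 1 − σ` wording: for `T ≥ T₁` and `0 ≤ η < c (log T)^{−5/7}`,
`N(1 − η, T) = 0`. [cite: Ivic1985, §11.4, proof of Theorem 11.3, p. 281] -/
theorem zetaZeroCountRe_one_sub_eq_zero_of_clamp :
    ∃ c : ℝ, 0 < c ∧ ∃ T₁ : ℝ, 3 ≤ T₁ ∧ ∀ T : ℝ, T₁ ≤ T →
      c / Real.log T ^ (5 / 7 : ℝ) ≤ 1 / 2 ∧
      ∀ η : ℝ, η < c / Real.log T ^ (5 / 7 : ℝ) → zetaZeroCountRe (1 - η) T = 0 := by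
  obtain ⟨c, hc, T₁, hT₁, h⟩ := zetaZeroCountRe_eq_zero_of_clamp
  refine ⟨c, hc, T₁, hT₁, fun T hT ↦ ⟨(h T hT).1, fun η hη ↦ (h T hT).2 (1 - η) (by linarith)⟩⟩

/-! ## (R3) The pole window: a bound for `|ζ(5σ − 4 + it)|` on all of `|t| ≤ 3T` -/

/-- `‖ζ(α − it)‖ = ‖ζ(α + it)‖` for real `α, t` (`ζ(s̄) = conj ζ(s)`, Mathlib `riemannZeta_conj`).
[cite: Ivic1985, §1.2, after (1.25), p. 9 (`ζ(s̄) = conj ζ(s)`); Titchmarsh1986, §2.1] -/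
theorem norm_zeta_line_neg (α t : ℝ) :
    ‖riemannZeta ((α : ℂ) + ((-t : ℝ) : ℂ) * I)‖ = ‖riemannZeta ((α : ℂ) + t * I)‖ := by
  have h : (α : ℂ) + ((-t : ℝ) : ℂ) * I = starRingEnd ℂ ((α : ℂ) + t * I) := by
    apply Complex.ext <;> simp
  rw [h, riemannZeta_conj, Complex.norm_conj]

/-- **The `|t|`-symmetric majorant** (the `hM` shape of the class-I count `IvicClassOne.count`):
if `|ζ(α + it)| ≤ M` for `1 ≤ t ≤ 3T`, then `|ζ(α + it)| ≤ M` for `1 ≤ |t| ≤ 3T` — negative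
ordinates by conjugation (`norm_zeta_line_neg`). Ivić's `M(α, 3T) = max_{1≤t≤3T}|ζ(α+it)|`
(Theorem 11.3) is used in (11.46)–(11.50) at ordinates `t_r − t_s` of both signs.
[cite: Ivic1985, §11.4, Theorem 11.3 (definition of `M(α,T)`) and (11.46)–(11.47), pp. 277, 280] -/
theorem norm_zeta_line_le_of_majorant_abs {α T M : ℝ}
    (hM : ∀ t : ℝ, 1 ≤ t → t ≤ 3 * T → ‖riemannZeta ((α : ℂ) + t * I)‖ ≤ M) :
    ∀ t : ℝ, 1 ≤ |t| → |t| ≤ 3 * T → ‖riemannZeta ((α : ℂ) + t * I)‖ ≤ M := by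
  intro t h1 h2
  rcases le_or_gt 0 t with ht | ht
  · rw [abs_of_nonneg ht] at h1 h2
    exact hM t h1 h2
  · rw [abs_of_neg ht] at h1 h2
    have key : ‖riemannZeta ((α : ℂ) + t * I)‖ =
        ‖riemannZeta ((α : ℂ) + ((-(-t) : ℝ) : ℂ) * I)‖ := by
      simp
    rw [key, norm_zeta_line_neg α (-t)]
    exact hM (-t) h1 h2

/-- **The pole window** (census F-E; Ivić's `M(α, 3T)` only sees `t ≥ 1`, while the Halász–Montgomery
kernels of (11.46)–(11.50) meet `ζ(α + it)` for all `|t| ≤ 3T`): for `9/10 ≤ σ < 1`,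
`α = 5σ − 4 ∈ [1/2, 1)`, a majorant `M ≥ 0` of `|ζ(α + it)|` on `1 ≤ t ≤ 3T` and the crude bound
`|ζ(α' + it)| ≤ 1/(1 − α') + K(1 + |t|)` on `1/2 ≤ α' < 1` (`K ≥ 0`,
`NearOneDetect.exists_norm_zeta_line_le`), one has for ALL `|t| ≤ 3T`
`|ζ(α + it)| ≤ M + 1/(5(1 − σ)) + 2K` (`1 − α = 5(1 − σ)`; on `|t| < 1` the crude bound, on
`1 ≤ |t| ≤ 3T` the majorant by `norm_zeta_line_le_of_majorant_abs`). This is the quantity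
`S := M + 1/(1 − α) + 2K` fed to `NearOneDensity.classOne_count_line` /
`NearOneDetect.norm_smoothedKernel_le_line` in the unit (census §R).
[cite: Ivic1985, §11.4, proof of Theorem 11.3, (11.46)–(11.47), p. 280]
[cite: Titchmarsh1986, §2.12 eq. (2.12.2)] -/
theorem norm_zeta_line_le_of_majorant {σ T M K : ℝ} (hσ : 9 / 10 ≤ σ) (hσ1 : σ < 1)
    (hM0 : 0 ≤ M) (hK : 0 ≤ K)
    (hM : ∀ t : ℝ, 1 ≤ t → t ≤ 3 * T → ‖riemannZeta (((5 * σ - 4 : ℝ) : ℂ) + t * I)‖ ≤ M)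
    (hKζ : ∀ α' t : ℝ, 1 / 2 ≤ α' → α' < 1 →
      ‖riemannZeta ((α' : ℂ) + t * I)‖ ≤ 1 / (1 - α') + K * (1 + |t|)) :
    ∀ t : ℝ, |t| ≤ 3 * T →
      ‖riemannZeta (((5 * σ - 4 : ℝ) : ℂ) + t * I)‖ ≤ M + 1 / (5 * (1 - σ)) + 2 * K := by
  intro t ht
  have hη : 0 < 1 - σ := by linarith
  have hpole : 0 ≤ 1 / (5 * (1 - σ)) := by positivity
  rcases lt_or_ge |t| 1 with h1 | h1
  · -- `|t| < 1`: the crude bound on the line `α' = 5σ − 4`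
    have hc := hKζ (5 * σ - 4) t (by linarith) (by linarith)
    have e : 1 / (1 - (5 * σ - 4)) = 1 / (5 * (1 - σ)) := by congr 1; ring
    rw [e] at hc
    have h2 : K * (1 + |t|) ≤ 2 * K := by nlinarith [abs_nonneg t]
    linarith
  · -- `1 ≤ |t| ≤ 3T`: the majorant
    have hm := norm_zeta_line_le_of_majorant_abs hM t h1 ht
    linarith

/-- **The pole window at height `U ≤ T`** (the `hS` shape of `NearOneDetect.classTwo_integral_le_line`
and `NearOneDetect.norm_smoothedKernel_le_line`, which ask for a bound on `|t| ≤ 3U` for the dyadic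
height block `(U, 2U]`): under the hypotheses of `norm_zeta_line_le_of_majorant` and `U ≤ T`,
`|ζ(5σ − 4 + it)| ≤ M + 1/(5(1 − σ)) + 2K` for `|t| ≤ 3U`.
[cite: Ivic1985, §11.4, proof of Theorem 11.3, (11.46)–(11.47), p. 280] -/
theorem norm_zeta_line_le_of_majorant_height {σ T M K U : ℝ} (hσ : 9 / 10 ≤ σ) (hσ1 : σ < 1)
    (hM0 : 0 ≤ M) (hK : 0 ≤ K) (hUT : U ≤ T)
    (hM : ∀ t : ℝ, 1 ≤ t → t ≤ 3 * T → ‖riemannZeta (((5 * σ - 4 : ℝ) : ℂ) + t * I)‖ ≤ M)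
    (hKζ : ∀ α' t : ℝ, 1 / 2 ≤ α' → α' < 1 →
      ‖riemannZeta ((α' : ℂ) + t * I)‖ ≤ 1 / (1 - α') + K * (1 + |t|)) :
    ∀ t : ℝ, |t| ≤ 3 * U →
      ‖riemannZeta (((5 * σ - 4 : ℝ) : ℂ) + t * I)‖ ≤ M + 1 / (5 * (1 - σ)) + 2 * K :=
  fun t ht ↦ norm_zeta_line_le_of_majorant hσ hσ1 hM0 hK hM hKζ t (ht.trans (by linarith))

/-- **The majorant is nonnegative once `T ≥ 1/3`** (it majorises `|ζ(α + i)| ≥ 0`); this supplies the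
hypothesis `0 ≤ M` of `norm_zeta_line_le_of_majorant` from the typed fact's data (and (R1) gives
the stronger `c₀ ≤ M`). [cite: Ivic1985, §11.4, Theorem 11.3 (the majorant `M(α,T)`), p. 277] -/
theorem majorant_nonneg {α T M : ℝ} (hT : 1 / 3 ≤ T)
    (hM : ∀ t : ℝ, 1 ≤ t → t ≤ 3 * T → ‖riemannZeta ((α : ℂ) + t * I)‖ ≤ M) : 0 ≤ M :=
  (norm_nonneg _).trans (hM 1 le_rfl (by linarith))

end IvicNearOneDetect

end Literature.NumberTheory.LFunctions
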